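/-
Copyright: the b2b-balaban T⁴-continuum CRUX team, row NE7b leaf lineage `t4-ne7b-formalise-leaf-06` (gen 156). Project licence.
-/
import Mathlib.Analysis.SpecialFunctions.Pow.Real
import Mathlib.Analysis.Normed.Operator.Basic
import Mathlib.Tactic.Positivity
import Mathlib.Tactic.Linarith
import Mathlib.Tactic.FieldSimp

/-!
# THE CLOSING FAMILY IN COERCIVITY UNITS: with every action measured in units of its own kernel coercivity, the step-plus-rescaling
# sends the dimensionless letters `(x_B, x_M·r, x_G∕r)` to `(x_B, x_M·r, x_G∕r) · K₁²d²∕γ` times `(1, λ(1 + 2x_BK₁), λ⁻¹)` — so the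
# tower closes with THE SAME `(N, c, λ)` and non-growing letters iff `K₁²d² ≤ γ` (Hessian size), `λ(1 + 2x_BK₁)K₁²d² ≤ γ`
# (modulus) and `K₁²d² ≤ λγ` (gradient over radius): the two-scale coercivity gain `γ∕d²` must beat the square of the chart
# constant `K₁ = (N⁻¹ − c)⁻¹`; no `t` anywhere — and since `K₁d ≥ 1` always, closing FORCES `γ ≥ 1`, which the free field
# violates (`γ = L⁻²`): a located negative letter on the crude size letter (row NE7b, node U5c; Mathlib only; [folklore] real
# arithmetic + one operator-norm inequality — HSTB re-read in the units of ASL; the numbers `γ, d, K₁` are (A3))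

Cell `pub-balaban`, sub-cell `t4`, spine estimate NE7b (`T4WeightBudget.RelWeightBound`; the cell's OWN estimate — NOT PRINTED in
[Bałaban 1983–89], NOT PROVED).  Crux-route work under `Spine/NE7b/` by a row leaf (`t4-ne7b-formalise-leaf-06` gen 156) in the
hard-step cell under FREEZE (0)'s crux-prover clause; NOTHING of Bałaban's is named as a Lean object, valued or asserted; no
`T4Continuum/Support` leaf typed; no `def`; zero `sorry`.  Imports: Mathlib only (fast lane).  Companions: this lineage's
`…HardStepTowerBox` (HSTB, p383624 ✓: the same box in MIXED units, conditions in `s = |t|K₁`), `…ActionScalingLetters` (ASL: the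
normalisation `V ↦ m⁻¹ • V` and the identities that remove `t`), `…HardStepTowerTwoSteps` (HSTT: whose `hN₂ ∕ hc₂r ∕ hr₂ρ` side
conditions §3 produces in unit form).

WHY.  HSTB answered «when do the two-step side conditions hold with the same `(N, c, r)`?» in the letter `s = |t|K₁` — but with the
action un-normalised, so that its `hN` hypothesis `(1 + s²B∕m)μ + m⁻¹ ≤ N` still carried the inverse-Hessian summand `m⁻¹` whose
size depends on the normalisation (F634).  In coercivity units (ASL) the question has a `t`-free answer.  Write `x_B := B∕m`
(Hessian size over kernel coercivity), `x_M := M₃∕m` (Hessian-Lipschitz over coercivity; the modulus letter is `c = x_M·r`), `x_G := G∕m`,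
`K₁ := (N⁻¹ − c)⁻¹` the chart constant, `γ := m₂∕m` the two-scale coercivity ratio and `d` the blocking's size (TFC), `λ ∈ (0,1]` the
fraction of the chart radius kept as the next fibre radius (`r′ = λK₁⁻¹r∕|t|`).  Then (ASL §3) the next letters in the NEXT
coercivity's units are `x_B′ = x_B·K₁²d²∕γ`, `x_M′r′ = λ(1 + 2x_BK₁)·x_M r·K₁²d²∕γ`, `x_G′∕r′ = λ⁻¹·(x_G∕r)·K₁²d²∕γ`, and the next
equivalence letter is `(1 + x_B′)‖M′‖ + 1`.  THIS FILE: the three letters do not grow, and the same `(N, c)` serve, exactly when the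
displayed products are `≤ 1` — three inequalities between `K₁²d²∕γ`, `λ` and `x_BK₁`, none containing `t`.  In words: the
BLOCKING's two-scale coercivity gain `γ∕d²` must dominate the CHART's squared condition number `K₁²`; the homothety plays no role
(F627 ∕ F644 «change of units, no margin» — here the margin is named).  Which `γ∕d²` print's averaging operators have is (A3);
leaf-01's TSPB ∕ FFTI value it for the free lattice field.  AND THE BOX IS HONESTLY SMALL (§3b): a section of the blocking costs
`‖σ′‖·‖D‖ ≥ 1`, so `K₁d ≥ 1` and the Hessian-size condition forces `γ ≥ 1` (`m₂ ≥ m`) — which Laplacian-type data violate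
(`γ = L⁻²` by TSPB's values: longer wavelengths live in `ker (D₂∘D)`).  So, like HSTB's radius letter in the `ℓ²` currency (leaf-01's
HRO, the pricing desk's F660), the crude SIZE letter `B⁺ = B‖σ′‖²` cannot close on the free field — here with no currency and no `t`
in the statement; the located debt is a transported-Hessian size letter through the chart's ENERGY seminorm (the minimiser smooths:
`⟨σ′k, V″σ′k⟩ ≪ ‖V″‖‖σ′k‖²`), which this file's arithmetic accepts verbatim in place of `K₁²` in `Θ`.

WHAT IS PROVED ([folklore]; all letters real; `Θ := K₁²·d²∕γ` written out):
* §1 THE NEXT LETTERS: `nextXB_le` (`Θ ≤ 1`, `x_B ≥ 0` ⟹ `x_B·Θ ≤ x_B`), `nextXB_le_iff` (`x_B > 0`: `x_B·Θ ≤ x_B ↔ Θ ≤ 1`),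
  `nextModulus_le` (`λ(1 + 2x_BK₁)Θ ≤ 1`, `x_M r ≥ 0` ⟹ `λ(1 + 2x_BK₁)·x_M r·Θ ≤ x_M r`), `nextGradientRatio_le`
  (`Θ ≤ λ`, `λ > 0`, `x_G∕r ≥ 0` ⟹ `λ⁻¹·(x_G∕r)·Θ ≤ x_G∕r`).
* §2 THE SAME `(N, c)` SERVE: `nextEquiv_le` (`(1 + x_B)μ + 1 ≤ N`, `x_B′ ≤ x_B`, `0 ≤ ‖M′‖ ≤ μ` ⟹ `(1 + x_B′)‖M′‖ + 1 ≤ N`),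
  `nextModulusLetter_le` (`x_M r ≤ c`, the §1 product `≤ x_M r` ⟹ the next modulus letter `≤ c`).
* §3 JUNCTION WITH HSTT's SHAPES (`t ≠ 0`): `hN_unit_of_box` — from `(1 + x_BΘ)μ + 1 ≤ N`, a next Hessian bound `‖Q′‖ ≤ t²·x_BK₁²`,
  `0 ≤ ‖M′‖ ≤ μ` and `γ, d > 0`: `(1 + ‖Q′‖∕(t²γ∕d²))‖M′‖ + 1 ≤ N` — `inductiveStep_unit`'s `hN` AT THE NEXT SCALE after re-normalising
  by the next coercivity `t²γ∕d²`; `modulusNeed_eq` ∕ `gradientRatio_eq` (ASL §3's closed forms ARE §1's products); `radius_unit` (`λ ≤ 1`, … ⟹ `λK₁⁻¹r∕|t| ≤ K₁⁻¹r∕|t|` and `< ` for `λ < 1` — HSTT's `hr₂ρ`).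
* §3b THE PRICE IS AT LEAST `γ ≥ 1` (normed spaces, `F` nontrivial): `one_le_norm_mul_norm_of_rightInverse` (`D∘S = id ⟹ 1 ≤ ‖D‖‖S‖`),
  **`one_le_gamma_of_closing`** (`‖σ′‖ ≤ K₁`, `‖D‖ ≤ d`, `Θ ≤ 1 ⟹ 1 ≤ γ`: closing in these units needs the two-scale coercivity
  to be at least the kernel coercivity, `m₂ ≥ m`, for ANY chart), **`not_closing_of_gamma_lt_one`** (LOCATED NEGATIVE LETTER: `γ < 1`
  ⟹ the Hessian-size condition fails for every chart and blocking size), **`free_field_gamma_lt_one`** (leaf-01's TSPB values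
  `m₂ = (L²(L²−1))⁻¹`, `m = (L²−1)⁻¹` give `γ = L⁻² < 1`): THE UNIT BOX DOES NOT CLOSE ON THE FREE FIELD WITH THE CRUDE SIZE LETTER
  `B⁺ = B‖σ′‖²` — the located debt is a transported-Hessian SIZE letter through the chart's energy seminorm (minimiser smoothing).
* §4 THE END `closing_family_unit` — the conjunction under the three smallness conditions: next letters `≤` current, the
  equivalence letter re-holds with the same `N`, the modulus letter with the same `c`.
* §5 toy: `K₁ = 2`, `d = 1∕2`, `γ = 2` (`Θ = 1∕2`), `λ = 1∕2`, `x_B = 1∕4` (`λ(1 + 2x_BK₁)Θ = 1∕2 ≤ 1`, `Θ ≤ λ`).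

NOT HERE (honest): `γ, d, K₁, λ, x_B` BY VALUE for print's small-field action ((A3) ∕ (A1c), NC-NE7b-α UNRULED); that `c = x_M r`
is the modulus letter one carries (a bookkeeping choice, displayed); the `n`-step tower; anything of Bałaban's.  BY-NAME EFFECT ON
THE WALL: NONE.  NE7b NOT PRINTED ∕ NOT PROVED; spine PROVED 0∕9; rung (B)+1 on a FINITE torus — NOT infinite volume, NOT the mass gap,
NOT Clay.  HONEST DEPENDENCY: continuum YM on T⁴ ⇐ BetaPertH ∧ nine spine estimates (0∕9 proved); BetaPertH ⇐ (D1) ∧ (D4) ∧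
CAP+tail; G-an2-4 gates asym, D1 and NE2∕3∕4.
-/

set_option autoImplicit false

namespace Summit.QuantumFields.BalabanUV.T4Continuum.NE7b.HardStepUnitBox

/-! ## §1. The next letters do not grow -/

/-- **NEXT HESSIAN SIZE**: `Θ = K₁²d²∕γ ≤ 1`, `x_B ≥ 0` ⟹ `x_B·K₁²d²∕γ ≤ x_B`. [folklore] -/
theorem nextXB_le {xB K₁ d γ : ℝ} (hxB : 0 ≤ xB) (hΘ : K₁ ^ 2 * d ^ 2 / γ ≤ 1) : xB * K₁ ^ 2 * d ^ 2 / γ ≤ xB := by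
  have e : xB * K₁ ^ 2 * d ^ 2 / γ = xB * (K₁ ^ 2 * d ^ 2 / γ) := by ring
  rw [e]
  nlinarith

/-- … and for `x_B > 0` this is an EQUIVALENCE: the Hessian size is non-growing iff `K₁²d² ∕ γ ≤ 1`. [folklore] -/
theorem nextXB_le_iff {xB K₁ d γ : ℝ} (hxB : 0 < xB) : xB * K₁ ^ 2 * d ^ 2 / γ ≤ xB ↔ K₁ ^ 2 * d ^ 2 / γ ≤ 1 := by
  have e : xB * K₁ ^ 2 * d ^ 2 / γ = xB * (K₁ ^ 2 * d ^ 2 / γ) := by ring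
  rw [e]
  constructor
  · intro h; nlinarith
  · intro h; nlinarith

/-- **NEXT MODULUS LETTER**: `λ(1 + 2x_BK₁)·K₁²d²∕γ ≤ 1`, `x_M r ≥ 0` ⟹ `λ(1 + 2x_BK₁)·(x_M r)·K₁²d²∕γ ≤ x_M r`. [folklore] -/
theorem nextModulus_le {xMr xB K₁ d γ lam : ℝ} (hx : 0 ≤ xMr) (h : lam * (1 + 2 * xB * K₁) * (K₁ ^ 2 * d ^ 2 / γ) ≤ 1) :
    lam * (1 + 2 * xB * K₁) * xMr * (K₁ ^ 2 * d ^ 2 / γ) ≤ xMr := by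
  have e : lam * (1 + 2 * xB * K₁) * xMr * (K₁ ^ 2 * d ^ 2 / γ) = (lam * (1 + 2 * xB * K₁) * (K₁ ^ 2 * d ^ 2 / γ)) * xMr := by
    ring
  rw [e]
  nlinarith

/-- **NEXT GRADIENT-TO-RADIUS RATIO**: `K₁²d²∕γ ≤ λ`, `λ > 0`, `x_G∕r ≥ 0` ⟹ `λ⁻¹·(x_G∕r)·K₁²d²∕γ ≤ x_G∕r`. [folklore] -/
theorem nextGradientRatio_le {g K₁ d γ lam : ℝ} (hg : 0 ≤ g) (hlam : 0 < lam) (h : K₁ ^ 2 * d ^ 2 / γ ≤ lam) :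
    lam⁻¹ * g * (K₁ ^ 2 * d ^ 2 / γ) ≤ g := by
  have h1 : lam⁻¹ * (K₁ ^ 2 * d ^ 2 / γ) ≤ 1 := by
    rw [inv_mul_le_iff₀ hlam]; linarith
  have e : lam⁻¹ * g * (K₁ ^ 2 * d ^ 2 / γ) = (lam⁻¹ * (K₁ ^ 2 * d ^ 2 / γ)) * g := by ring
  rw [e]
  nlinarith

/-! ## §2. The same `(N, c)` serve -/

/-- **THE SAME EQUIVALENCE BOUND**: `(1 + x_B)μ + 1 ≤ N`, `x_B′ ≤ x_B`, `0 ≤ ‖M′‖ ≤ μ` ⟹ `(1 + x_B′)‖M′‖ + 1 ≤ N` (monotone;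
needs `0 ≤ 1 + x_B′`, granted by `x_B′ ≥ 0`). [folklore] -/
theorem nextEquiv_le {xB xB' nM μ N : ℝ} (hxB' : 0 ≤ xB') (hle : xB' ≤ xB) (hnM : 0 ≤ nM) (hnMμ : nM ≤ μ)
    (h : (1 + xB) * μ + 1 ≤ N) : (1 + xB') * nM + 1 ≤ N := by
  have hμ : 0 ≤ μ := hnM.trans hnMμ
  have h1 : (1 + xB') * nM ≤ (1 + xB) * μ := mul_le_mul (by linarith) hnMμ hnM (by linarith)
  linarith

/-- **THE SAME MODULUS**: if the modulus letter carried is `c ≥ x_M r` and the next product is `≤ x_M r`, the next modulus letter is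
`≤ c`. [folklore] -/
theorem nextModulusLetter_le {xMr xB K₁ d γ lam c : ℝ} (hx : 0 ≤ xMr) (hc : xMr ≤ c)
    (h : lam * (1 + 2 * xB * K₁) * (K₁ ^ 2 * d ^ 2 / γ) ≤ 1) :
    lam * (1 + 2 * xB * K₁) * xMr * (K₁ ^ 2 * d ^ 2 / γ) ≤ c :=
  (nextModulus_le hx h).trans hc

/-! ## §3. Junction with HSTT's shapes -/

/-- **`inductiveStep_unit`'s `hN` AT THE NEXT SCALE.**  From the unit-box inequality `(1 + x_B·K₁²d²∕γ)μ + 1 ≤ N`, a bound on the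
next (rescaled, un-renormalised) Hessian `‖Q′‖ ≤ t²·(x_B K₁²)`, `0 ≤ ‖M′‖ ≤ μ`, `t ≠ 0`, `γ, d > 0`, `x_B ≥ 0`:
`(1 + ‖Q′‖ ∕ (t²·(γ∕d²)))·‖M′‖ + 1 ≤ N` — the dimensionless equivalence letter with the next coercivity `t²γ∕d²`. [folklore] -/
theorem hN_unit_of_box {xB K₁ d γ μ N t nQ nM : ℝ} (ht : t ≠ 0) (hγ : 0 < γ) (hd : 0 < d) (hxB : 0 ≤ xB)
    (hQ : nQ ≤ t ^ 2 * (xB * K₁ ^ 2)) (hnM : 0 ≤ nM) (hnMμ : nM ≤ μ)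
    (h : (1 + xB * K₁ ^ 2 * d ^ 2 / γ) * μ + 1 ≤ N) :
    (1 + nQ / (t ^ 2 * (γ / d ^ 2))) * nM + 1 ≤ N := by
  have ht2 : 0 < t ^ 2 := by positivity
  have hden : 0 < t ^ 2 * (γ / d ^ 2) := mul_pos ht2 (div_pos hγ (by positivity))
  have h1 : nQ / (t ^ 2 * (γ / d ^ 2)) ≤ t ^ 2 * (xB * K₁ ^ 2) / (t ^ 2 * (γ / d ^ 2)) :=
    div_le_div_of_nonneg_right hQ hden.le
  have e : t ^ 2 * (xB * K₁ ^ 2) / (t ^ 2 * (γ / d ^ 2)) = xB * K₁ ^ 2 * d ^ 2 / γ := by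
    rw [mul_div_mul_left _ _ ht2.ne', div_div_eq_mul_div]
  rw [e] at h1
  have hx' : 0 ≤ xB * K₁ ^ 2 * d ^ 2 / γ := by positivity
  have h2 : 0 ≤ nQ / (t ^ 2 * (γ / d ^ 2)) + (xB * K₁ ^ 2 * d ^ 2 / γ - nQ / (t ^ 2 * (γ / d ^ 2))) := by linarith
  have hμ : 0 ≤ μ := hnM.trans hnMμ
  have h3 : (1 + nQ / (t ^ 2 * (γ / d ^ 2))) * nM ≤ (1 + xB * K₁ ^ 2 * d ^ 2 / γ) * μ := by
    have h4 : (1 + nQ / (t ^ 2 * (γ / d ^ 2))) * nM ≤ (1 + xB * K₁ ^ 2 * d ^ 2 / γ) * nM := by nlinarith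
    have h5 : (1 + xB * K₁ ^ 2 * d ^ 2 / γ) * nM ≤ (1 + xB * K₁ ^ 2 * d ^ 2 / γ) * μ :=
      mul_le_mul_of_nonneg_left hnMμ (by linarith)
    linarith
  linarith

/-- **THE NEXT RADIUS IS A FRACTION OF THE CHART RADIUS**: `0 < λ < 1`, `K₁, r > 0`, `t ≠ 0` ⟹ `0 < λK₁⁻¹r∕|t| < K₁⁻¹r∕|t|`
(HSTT's `hr₂ : 0 < r₂` and `hr₂ρ : r₂ < ρ∕|t|` with `ρ = K₁⁻¹r`). [folklore] -/
theorem radius_unit {lam K₁ r t : ℝ} (hlam : 0 < lam) (hlam1 : lam < 1) (hK : 0 < K₁) (hr : 0 < r) (ht : t ≠ 0) :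
    0 < lam * (K₁⁻¹ * r) / |t| ∧ lam * (K₁⁻¹ * r) / |t| < K₁⁻¹ * r / |t| := by
  have ht' : 0 < |t| := abs_pos.mpr ht
  have hρ : 0 < K₁⁻¹ * r := mul_pos (inv_pos.mpr hK) hr
  refine ⟨div_pos (mul_pos hlam hρ) ht', div_lt_div_of_pos_right ?_ ht'⟩
  nlinarith

/-- **JUNCTION WITH ASL's CLOSED FORM**: ASL's `nextModulusNeed_unit` writes the next modulus need as `λ·Λ·(K₁⁻¹r)·d²∕γ` with
`Λ = x_M K₁³(1 + 2x_BK₁)` (HSIS's next Hessian-Lipschitz constant in unit letters); for `K₁ ≠ 0` this IS §1's product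
`λ(1 + 2x_BK₁)·(x_M r)·K₁²d²∕γ`. [folklore] -/
theorem modulusNeed_eq {xM xB K₁ d γ lam r : ℝ} (hK : K₁ ≠ 0) :
    lam * (xM * K₁ ^ 3 * (1 + 2 * xB * K₁)) * (K₁⁻¹ * r) * d ^ 2 / γ =
      lam * (1 + 2 * xB * K₁) * (xM * r) * (K₁ ^ 2 * d ^ 2 / γ) := by
  field_simp

/-- **JUNCTION, GRADIENT**: ASL's `nextGradientOverRadius_unit` value `x_G K₁² d²∕(γλr)` IS §1's `λ⁻¹·(x_G∕r)·K₁²d²∕γ`. [folklore] -/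
theorem gradientRatio_eq (xG K₁ d γ lam r : ℝ) :
    xG * K₁ ^ 2 * d ^ 2 / (γ * lam * r) = lam⁻¹ * (xG / r) * (K₁ ^ 2 * d ^ 2 / γ) := by
  rw [div_eq_mul_inv, div_eq_mul_inv, div_eq_mul_inv, mul_inv, mul_inv]
  ring

/-! ## §3b. The price is at least `γ ≥ 1`: a chart constant is never below the inverse blocking size -/

section Price

variable {E F : Type*} [NormedAddCommGroup E] [NormedSpace ℝ E] [NormedAddCommGroup F] [NormedSpace ℝ F]

/-- **A SECTION COSTS AT LEAST THE INVERSE OF THE MAP**: `D (S k) = k` for all `k`, `F` nontrivial ⟹ `1 ≤ ‖D‖·‖S‖`. [folklore] -/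
theorem one_le_norm_mul_norm_of_rightInverse [Nontrivial F] (D : E →L[ℝ] F) (S : F →L[ℝ] E) (h : ∀ k, D (S k) = k) :
    1 ≤ ‖D‖ * ‖S‖ := by
  obtain ⟨k, hk⟩ := exists_ne (0 : F)
  have hk' : 0 < ‖k‖ := norm_pos_iff.mpr hk
  have h1 : ‖k‖ ≤ ‖D‖ * ‖S‖ * ‖k‖ := by
    calc ‖k‖ = ‖D (S k)‖ := by rw [h]
      _ ≤ ‖D‖ * ‖S k‖ := D.le_opNorm _
      _ ≤ ‖D‖ * (‖S‖ * ‖k‖) := mul_le_mul_of_nonneg_left (S.le_opNorm _) (norm_nonneg _)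
      _ = ‖D‖ * ‖S‖ * ‖k‖ := by ring
  by_contra hlt
  rw [not_le] at hlt
  nlinarith

/-- **HENCE `K₁·d ≥ 1`**: any bound `K₁ ≥ ‖σ′‖` on a section `σ′` of the blocking `D` and any size `d ≥ ‖D‖` satisfy `1 ≤ K₁·d` —
so `Θ = K₁²d²∕γ ≥ γ⁻¹`, and the closing condition `Θ ≤ 1` of §1 FORCES `γ ≥ 1`: the two-scale coercivity must be at least the
kernel coercivity (`m₂ ≥ m`), whatever the chart. [folklore] -/
theorem one_le_gamma_of_closing [Nontrivial F] (D : E →L[ℝ] F) (S : F →L[ℝ] E) (h : ∀ k, D (S k) = k) {K₁ d γ : ℝ}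
    (hK : ‖S‖ ≤ K₁) (hd : ‖D‖ ≤ d) (hγ : 0 < γ) (hΘ : K₁ ^ 2 * d ^ 2 / γ ≤ 1) : 1 ≤ γ := by
  have h1 := one_le_norm_mul_norm_of_rightInverse D S h
  have hD : 0 ≤ ‖D‖ := norm_nonneg _
  have hS : 0 ≤ ‖S‖ := norm_nonneg _
  have h2 : 1 ≤ K₁ * d := by nlinarith [mul_le_mul hd hK hS (hD.trans hd)]
  have h3 : 1 ≤ K₁ ^ 2 * d ^ 2 := by nlinarith
  have h4 : K₁ ^ 2 * d ^ 2 ≤ γ := by rwa [div_le_one hγ] at hΘ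
  linarith

/-- **LOCATED NEGATIVE LETTER — THE BOX IS EMPTY WHEN `γ < 1`.**  If the two-scale coercivity ratio is `< 1` then NO chart constant
`K₁ ≥ ‖σ′‖` and NO blocking size `d ≥ ‖D‖` satisfy the Hessian-size closing condition `K₁²d²∕γ ≤ 1` (contrapositive of
`one_le_gamma_of_closing`).  Laplacian-type two-scale data HAVE `γ < 1` (`free_field_gamma_lt_one`): the crude transported-Hessian
size `B⁺ = B·‖σ′‖²` (HSAH) cannot be non-growing in coercivity units — in ANY currency, for ANY `t`; the located debt is a SIZE letter
carrying the chart's energy seminorm (the minimiser's smoothing), not `K₁`. [folklore] -/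
theorem not_closing_of_gamma_lt_one [Nontrivial F] (D : E →L[ℝ] F) (S : F →L[ℝ] E) (h : ∀ k, D (S k) = k) {K₁ d γ : ℝ}
    (hK : ‖S‖ ≤ K₁) (hd : ‖D‖ ≤ d) (hγ : 0 < γ) (hγ1 : γ < 1) : ¬ (K₁ ^ 2 * d ^ 2 / γ ≤ 1) := fun hΘ =>
  absurd (one_le_gamma_of_closing D S h hK hd hγ hΘ) (not_le.mpr hγ1)

end Price

/-- **THE FREE FIELD's RATIO BY VALUE**: with leaf-01's TSPB letters — two-scale coercivity `m₂ = (L²(L² − 1))⁻¹` (the cube of side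
`L²`) against the carried kernel coercivity `m = (L² − 1)⁻¹` — the ratio is `γ = m₂∕m = (L²)⁻¹ < 1` for `L > 1`: longer wavelengths
live in `ker (D₂ ∘ D)`.  (So §3b's necessary condition fails for the free lattice field: the unit box of this file does not close on
it with the crude size letter — consistent with leaf-01's HRO ∕ the pricing desk's F660 for the mixed-units box, and sharper: no
currency and no `t` are involved.) [folklore] -/
theorem free_field_gamma_lt_one {L : ℝ} (hL : 1 < L) :
    (L ^ 2 * (L ^ 2 - 1))⁻¹ / (L ^ 2 - 1)⁻¹ = (L ^ 2)⁻¹ ∧ (L ^ 2)⁻¹ < 1 := by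
  have hL2 : 1 < L ^ 2 := by nlinarith
  have h1 : L ^ 2 - 1 ≠ 0 := by linarith
  have h2 : (L ^ 2) ≠ 0 := by positivity
  refine ⟨?_, inv_lt_one_of_one_lt₀ hL2⟩
  rw [mul_inv, div_eq_mul_inv, inv_inv, mul_assoc, inv_mul_cancel₀ h1, mul_one]

/-! ## §4. The END: the closing family in coercivity units -/

/-- **THE CLOSING FAMILY IN COERCIVITY UNITS.**  Letters `x_B, x_M r, x_G∕r ≥ 0`, chart constant `K₁`, two-scale data `γ, d`, radius
fraction `0 < λ`; smallness `K₁²d²∕γ ≤ 1`, `λ(1 + 2x_BK₁)K₁²d²∕γ ≤ 1`, `K₁²d²∕γ ≤ λ`; the carried equivalence letter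
`(1 + x_B)μ + 1 ≤ N` with `0 ≤ ‖M′‖ ≤ μ` and modulus letter `x_M r ≤ c` ⟹ the next letters do not grow
(`x_B′ ≤ x_B`, `x_M′r′ ≤ x_M r`, `x_G′∕r′ ≤ x_G∕r`), the equivalence letter re-holds with the SAME `N` and the modulus letter with the
SAME `c` — and no `t` occurs. [folklore] -/
theorem closing_family_unit {xB xMr g K₁ d γ lam μ nM N c : ℝ} (hxB : 0 ≤ xB) (hx : 0 ≤ xMr) (hg : 0 ≤ g) (hlam : 0 < lam)
    (hΘ : K₁ ^ 2 * d ^ 2 / γ ≤ 1) (hΘM : lam * (1 + 2 * xB * K₁) * (K₁ ^ 2 * d ^ 2 / γ) ≤ 1) (hΘl : K₁ ^ 2 * d ^ 2 / γ ≤ lam)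
    (hΘ0 : 0 ≤ K₁ ^ 2 * d ^ 2 / γ)
    (hnM : 0 ≤ nM) (hnMμ : nM ≤ μ) (hN : (1 + xB) * μ + 1 ≤ N) (hc : xMr ≤ c) :
    xB * K₁ ^ 2 * d ^ 2 / γ ≤ xB ∧
      lam * (1 + 2 * xB * K₁) * xMr * (K₁ ^ 2 * d ^ 2 / γ) ≤ xMr ∧
      lam⁻¹ * g * (K₁ ^ 2 * d ^ 2 / γ) ≤ g ∧
      (1 + xB * K₁ ^ 2 * d ^ 2 / γ) * nM + 1 ≤ N ∧
      lam * (1 + 2 * xB * K₁) * xMr * (K₁ ^ 2 * d ^ 2 / γ) ≤ c := by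
  have h1 := nextXB_le hxB hΘ
  have hxB' : 0 ≤ xB * K₁ ^ 2 * d ^ 2 / γ := by
    have e : xB * K₁ ^ 2 * d ^ 2 / γ = xB * (K₁ ^ 2 * d ^ 2 / γ) := by ring
    rw [e]; exact mul_nonneg hxB hΘ0
  exact ⟨h1, nextModulus_le hx hΘM, nextGradientRatio_le hg hlam hΘl, nextEquiv_le hxB' h1 hnM hnMμ hN,
    nextModulusLetter_le hx hc hΘM⟩

/-! ## §5. Toy -/

/-- Toy: `K₁ = 2`, `d = 1∕2`, `γ = 2` (`Θ = 4·(1∕4)∕2 = 1∕2`), `λ = 1∕2`, `x_B = 1∕4`: the three smallness conditions hold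
(`Θ = 1∕2 ≤ 1`, `λ(1 + 2x_BK₁)Θ = (1∕2)·2·(1∕2) = 1∕2 ≤ 1`, `Θ ≤ λ`). -/
example : (2 : ℝ) ^ 2 * (1 / 2 : ℝ) ^ 2 / 2 ≤ 1 ∧
    (1 / 2 : ℝ) * (1 + 2 * (1 / 4 : ℝ) * 2) * ((2 : ℝ) ^ 2 * (1 / 2 : ℝ) ^ 2 / 2) ≤ 1 ∧
    (2 : ℝ) ^ 2 * (1 / 2 : ℝ) ^ 2 / 2 ≤ (1 / 2 : ℝ) := by
  norm_num

/-! ## §6 (v1.1, append-only). THE CHART LETTER EMPTIES THE BOX — the pricing desk's located price (refuter g97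
[NE7bREF-G97-LOCUS2-WORD], kernel instrument `scratch/g97_UnitBoxVacuity.lean`) as real arithmetic: with the chart constant fed by
AHE's equivalence bound (`N ≥ (1 + x_B)‖M‖ + 1`, `K₁ = (N⁻¹ − c)⁻¹ ≥ N`), a section's cost `‖M‖‖D‖ ≥ 1`, and the two-scale
coercivity never above the Hessian size (`γ ≤ x_B` as soon as `ker (D₂∘D) ≠ 0`), the Hessian-size ratio is `Θ = K₁²d²∕γ ≥ (1 + x_B)²∕x_B ≥ 4`:
§4's `closing_family_unit` and HSUT's `twoSteps_unit_of_box` are TRUE AND EMPTY on every non-trivial blocking — §3b's `γ ≥ 1` was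
the weak form.  The located culprit is the CHART letter (AHE's global `N`), the second crude letter beside the size letter (THEC). -/

section ChartLetter

/-- `K₁ = (N⁻¹ − c)⁻¹ ≥ N` for `0 < N`, `0 ≤ c < N⁻¹`. [folklore] -/
theorem le_inv_inv_sub {N c : ℝ} (hN : 0 < N) (hc0 : 0 ≤ c) (hc : c < N⁻¹) : N ≤ (N⁻¹ - c)⁻¹ := by
  have hP : 0 < N⁻¹ - c := sub_pos.mpr hc
  rw [le_inv_comm₀ hN hP]
  linarith [inv_pos.mpr hN]

/-- **THE TWO-SCALE COERCIVITY IS NEVER ABOVE THE HESSIAN SIZE**: if `m₂‖v‖² ≤ Q v v` for some `v ≠ 0` and `Q v v ≤ B‖v‖²`, then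
`m₂ ≤ B`; hence `γ = m₂∕m ≤ B∕m = x_B`. [folklore] -/
theorem twoScale_le_size {V : Type*} [NormedAddCommGroup V] {Q : V → ℝ} {m₂ B : ℝ} {v : V} (hv : v ≠ 0)
    (hco : m₂ * ‖v‖ ^ 2 ≤ Q v) (hQ : Q v ≤ B * ‖v‖ ^ 2) : m₂ ≤ B := by
  have h : 0 < ‖v‖ ^ 2 := by positivity
  exact le_of_mul_le_mul_right (hco.trans hQ) h

/-- **`Θ ≥ (1 + x_B)²∕x_B ≥ 4`**: `N ≤ K₁`, `(1 + x)·μ + 1 ≤ N` (AHE's letter, `μ = ‖M‖ ≥ 0`), `1 ≤ μ·d₀` (the section's cost),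
`0 ≤ d₀ ≤ d` (`d₀ = ‖D‖`), `0 < γ ≤ x` ⟹ `4 ≤ K₁²d²∕γ`. [folklore] -/
theorem four_le_theta_of_chartLetter {K₁ N x μ d₀ d γ : ℝ} (hK : N ≤ K₁) (hN : (1 + x) * μ + 1 ≤ N) (hμ : 0 ≤ μ)
    (hMD : 1 ≤ μ * d₀) (hd₀ : 0 ≤ d₀) (hd : d₀ ≤ d) (hγ : 0 < γ) (hγx : γ ≤ x) : 4 ≤ K₁ ^ 2 * d ^ 2 / γ := by
  have hx : 0 < x := lt_of_lt_of_le hγ hγx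
  have h1 : 1 + x ≤ K₁ * d := by
    have h2 : (1 + x) * (μ * d₀) ≤ ((1 + x) * μ + 1) * d₀ := by nlinarith
    have h3 : ((1 + x) * μ + 1) * d₀ ≤ N * d₀ := mul_le_mul_of_nonneg_right hN hd₀
    have hN0 : 0 ≤ N := by nlinarith
    have h4 : N * d₀ ≤ K₁ * d := mul_le_mul hK hd hd₀ (hN0.trans hK)
    nlinarith
  have h5 : (1 + x) ^ 2 ≤ K₁ ^ 2 * d ^ 2 := by
    have h0 : 0 ≤ 1 + x := by linarith
    nlinarith [mul_self_le_mul_self h0 h1]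
  rw [le_div_iff₀ hγ]
  nlinarith [sq_nonneg (1 - x)]

/-- **THE BOX IS EMPTY UNDER THE CHART LETTER**: with the letters of `four_le_theta_of_chartLetter`, `Θ ≤ 1` is FALSE — §4's
`closing_family_unit` (and HSUT §3) have no non-trivial instance while `K₁` is fed by AHE's global equivalence bound. [folklore] -/
theorem not_box_of_chartLetter {K₁ N x μ d₀ d γ : ℝ} (hK : N ≤ K₁) (hN : (1 + x) * μ + 1 ≤ N) (hμ : 0 ≤ μ)
    (hMD : 1 ≤ μ * d₀) (hd₀ : 0 ≤ d₀) (hd : d₀ ≤ d) (hγ : 0 < γ) (hγx : γ ≤ x) : ¬ (K₁ ^ 2 * d ^ 2 / γ ≤ 1) := fun h => by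
  linarith [four_le_theta_of_chartLetter hK hN hμ hMD hd₀ hd hγ hγx]

end ChartLetter

end Summit.QuantumFields.BalabanUV.T4Continuum.NE7b.HardStepUnitBox
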